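/-
Copyright (c) 2026 the pub-hodgecm-mathlib formalisation cell (harness21).  Prover seat hodgecm-mathlib-K2Liu-p01 (g7), Track B «K2-LIT»,
#184♮ = hLiu418 = `stmt-HodgeConjecture-24832`; #42S organ S1 ROAD W, RULING «M-158a» (2)+ADDENDUM ∕ «M-158c» («K2Liu-p01 = F7»); organ lead K2Liu-p06 (g4) DESIGN-W3-v2 §1 (ii);
my line 11:11:50Z: F7c `K2LiuLocalSWTruncatedCounts`, algebraic core F7c-A.
-/
import Mathlib.LinearAlgebra.Matrix.ConjTranspose
import Mathlib.Data.Matrix.Mul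
import Mathlib.Algebra.Star.Basic
import Mathlib.Algebra.BigOperators.Fin
import Mathlib.Tactic.LinearCombination
import HarnessLib

/-!
# Crux `HLiu418`, #42S-S1 ROAD W, brick F7c-A: THE HERMITIAN RANK-ONE UPDATE `A ↦ A·B* + B·A*` — HERMITIAN VALUES, KERNEL `{t·B : t + t̄ = 0}` FOR A PRIMITIVE `B`,
# IMAGE INSIDE THE HYPERPLANE `v*·H·v̄ = 0` (`v ⊥ B`), AND (RANK 2) ONTO IT WHEN TRACES ARE SURJECTIVE

Cell `hodgecm-mathlib`, crux item hLiu418 = `stmt-HodgeConjecture-24832` (helper lane `--supports … --as helper`, count-neutral).  THEOREMS ONLY (no `def`, no instance, no notation,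
no named-fact hypothesis, no `sorry`).  PURE ALGEBRA over a commutative `StarRing` `R` (consumer: `R = 𝒪_{E_w}∕ϖ^m` or `E_w`, `star = ` the Galois involution); the update is written out
as `vecMulVec A (star B) + vecMulVec B (star A)` (no definition).

WHY (DESIGN-W3-v2 §1 (ii), the (W3) closer of record at inert unramified `v`, M-158a (2)).  The truncated big-cell count `T^ε(m) = q^{4m}·vol{(A,B,C) : B primitive, AB* + BA* + d·CC* ∈ ϖ^m Herm₂}`
is computed by Fubini over `(B, C, A)`: for `B` PRIMITIVE (a unit coordinate) the `𝒪_F`-linear map `A ↦ AB* + BA*` has KERNEL `{t·B : t + t̄ = 0}` (so of order `q^m` mod `ϖ^m` at an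
unramified place) and IMAGE the hyperplane `{H = H* : v*Hv̄ = 0}`, `v ⊥ B` (order `q^{3m}`), whence the `A`-volume `q^{−3m}·𝟙[v*(dCC*)v̄ ≡ 0]`.  This file is that linear algebra, once,
over any commutative star-ring: §1 `conjTranspose_update` (values are hermitian), `update_smul_of_skew` (`t + t̄ = 0 ⇒ t·B ↦ 0`); §2 **`update_eq_zero_iff`** (unit coordinate `B i₀`:
`AB* + BA* = 0 ↔ ∃ t, star t = −t ∧ A = t • B`); §3 **`orth_update_orth`** (`Σᵢⱼ vᵢ Hᵢⱼ v̄ⱼ = 0` for `Σ vᵢ Bᵢ = 0`); §4 RANK 2, `B = (b₀, b₁)` with `b₀` a unit, `v = (b₁, −b₀)`: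
**`exists_update_eq_of_orth`** — every hermitian `H` with `v*Hv̄ = 0` is an update, provided traces are surjective onto the self-adjoint elements (`∀ r = r̄, ∃ t, t + t̄ = r`: unramified
`E_w∕F_v`, or `2 ∈ Rˣ`).  [Jacobowitz1962, §4] [Shimura1997, §13] (hermitian lattices over local rings); the counts themselves are F7c-B.
HONEST LABEL.  Count-neutral helper; `HC_CM` is proved only modulo the 7 printed citations (2 remaining named inputs: hLiu418 = `stmt-HodgeConjecture-24832`,
h413 = `stmt-HodgeConjecture-24833`) until rung 0 closes.

## References
* [Jacobowitz1962] R. Jacobowitz, *Hermitian forms over local fields*, Amer. J. Math. 84 (1962), §4.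
* [Shimura1997] G. Shimura, *Euler products and Eisenstein series*, CBMS 93 (1997), §13 (local densities of hermitian forms).
-/

set_option autoImplicit false
set_option linter.dupNamespace false -- the mandated namespace repeats `HodgeConjecture.HodgeConjecture`

open Matrix

namespace Summit.HodgeConjecture.HodgeConjecture.Cruxes.HLiu418.K2LiuHermitianRankOneUpdateKernel

variable {R : Type*} [CommRing R] [StarRing R] {n : ℕ}

/-! ## §1 The update is hermitian; skew multiples of `B` are killed -/

/-- `(A·B* + B·A*)* = A·B* + B·A*`. [cite: Jacobowitz1962, §4] -/
theorem conjTranspose_update (A B : Fin n → R) :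
    (vecMulVec A (star B) + vecMulVec B (star A))ᴴ = vecMulVec A (star B) + vecMulVec B (star A) := by
  ext i j
  simp only [conjTranspose_apply, add_apply, vecMulVec_apply, Pi.star_apply, star_add, star_mul', star_star]
  ring

/-- entries: `(A·B* + B·A*)ᵢⱼ = Aᵢ B̄ⱼ + Bᵢ Āⱼ`. [folklore] -/
theorem update_apply (A B : Fin n → R) (i j : Fin n) :
    (vecMulVec A (star B) + vecMulVec B (star A)) i j = A i * star (B j) + B i * star (A j) := by
  rw [add_apply, vecMulVec_apply, vecMulVec_apply, Pi.star_apply, Pi.star_apply]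

/-- **skew multiples of `B` are in the kernel**: `star t = −t ⇒ (t•B)·B* + B·(t•B)* = 0`. [cite: Jacobowitz1962, §4] -/
theorem update_smul_of_skew (B : Fin n → R) {t : R} (ht : star t = -t) :
    vecMulVec (t • B) (star B) + vecMulVec B (star (t • B)) = 0 := by
  ext i j
  rw [update_apply, zero_apply, Pi.smul_apply, Pi.smul_apply, smul_eq_mul, smul_eq_mul, star_mul', ht]
  ring

/-! ## §2 The kernel for a primitive `B` -/

/-- **THE KERNEL**: if `B i₀` is a unit, `A·B* + B·A* = 0 ↔ ∃ t, star t = −t ∧ A = t • B` (`t = A i₀ ∕ B i₀`). [cite: Jacobowitz1962, §4] [cite: Shimura1997, §13] -/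
theorem update_eq_zero_iff (A B : Fin n → R) {i₀ : Fin n} (hB : IsUnit (B i₀)) :
    vecMulVec A (star B) + vecMulVec B (star A) = 0 ↔ ∃ t : R, star t = -t ∧ A = t • B := by
  constructor
  · intro h
    obtain ⟨u, hu⟩ := hB
    have hsu : IsUnit (star (u : R)) := isUnit_star.2 u.isUnit
    obtain ⟨w, hw⟩ := hsu
    -- `t := A i₀ · u⁻¹`
    refine ⟨A i₀ * ↑u⁻¹, ?_, ?_⟩
    · -- entry `(i₀, i₀)`: `A i₀ ū + u star(A i₀) = 0`
      have h00 := congrFun (congrFun h i₀) i₀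
      rw [update_apply, zero_apply, ← hu] at h00
      rw [star_mul', neg_mul_eq_neg_mul]
      -- multiply the target by the unit `u ū`
      have key : (star (A i₀) * star (↑u⁻¹ : R)) * ((u : R) * star (u : R)) = (-A i₀ * ↑u⁻¹) * ((u : R) * star (u : R)) := by
        have e1 : star (↑u⁻¹ : R) * star (u : R) = 1 := by rw [← star_mul', Units.inv_mul, star_one]
        calc star (A i₀) * star (↑u⁻¹ : R) * ((u : R) * star (u : R)) = (u : R) * star (A i₀) * (star (↑u⁻¹ : R) * star (u : R)) := by ring
          _ = (u : R) * star (A i₀) := by rw [e1, mul_one]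
          _ = -(A i₀ * star (u : R)) := by rw [← sub_eq_zero, sub_neg_eq_add, add_comm]; exact h00
          _ = -A i₀ * ↑u⁻¹ * ((u : R) * star (u : R)) := by rw [mul_assoc, ← mul_assoc (↑u⁻¹ : R), Units.inv_mul, one_mul, neg_mul]
      have hunit : IsUnit ((u : R) * star (u : R)) := u.isUnit.mul (isUnit_star.2 u.isUnit)
      exact hunit.mul_left_injective key
    · funext i
      have hi := congrFun (congrFun h i) i₀
      rw [update_apply, zero_apply, ← hu] at hi
      rw [Pi.smul_apply, smul_eq_mul]
      -- `A i ū = −B i star(A i₀)` and `star (A i₀) = −ū⁻¹… ` : divide by the unit `ū`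
      have hsu' : IsUnit (star (u : R)) := isUnit_star.2 u.isUnit
      refine hsu'.mul_left_injective ?_
      change A i * star (u : R) = A i₀ * ↑u⁻¹ * B i * star (u : R)
      have h00 := congrFun (congrFun h i₀) i₀
      rw [update_apply, zero_apply, ← hu] at h00
      -- from `h00`: `u · star(A i₀) = −A i₀ · ū`, so `star (A i₀) = −A i₀ ū u⁻¹`
      have hstar : star (A i₀) = -(A i₀ * star (u : R) * ↑u⁻¹) := by
        have : (u : R) * (star (A i₀) + A i₀ * star (u : R) * ↑u⁻¹) = 0 := by
          rw [mul_add, show (u : R) * (A i₀ * star (u : R) * ↑u⁻¹) = A i₀ * star (u : R) by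
            rw [mul_comm (u : R), mul_assoc, Units.inv_mul, mul_one], add_comm]
          exact h00
        have h2 := (u.isUnit.mul_right_injective (this.trans (mul_zero _).symm))
        exact eq_neg_of_add_eq_zero_left h2
      have : A i * star (u : R) = -(B i * star (A i₀)) := eq_neg_of_add_eq_zero_left hi
      rw [this, hstar]
      ring
  · rintro ⟨t, ht, rfl⟩
    exact update_smul_of_skew B ht

/-! ## §3 The image lies in the hyperplane `v*·H·v̄ = 0` for `v ⊥ B` -/

/-- **`v ⊥ B` (`Σ vᵢ Bᵢ = 0`) ⇒ `Σᵢⱼ vᵢ (A·B* + B·A*)ᵢⱼ star(vⱼ) = 0`**: the image of the update lies in a hyperplane of the hermitian matrices. [cite: Jacobowitz1962, §4] -/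
theorem orth_update_orth (A B v : Fin n → R) (hv : ∑ i, v i * B i = 0) :
    ∑ i, ∑ j, v i * (vecMulVec A (star B) + vecMulVec B (star A)) i j * star (v j) = 0 := by
  have hv' : ∑ j, star (B j) * star (v j) = 0 := by
    calc ∑ j, star (B j) * star (v j) = ∑ j, star (v j * B j) := Finset.sum_congr rfl fun j _ => by rw [star_mul', mul_comm]
      _ = star (∑ j, v j * B j) := (star_sum _ _).symm
      _ = 0 := by rw [hv, star_zero]
  simp only [update_apply, mul_add, add_mul, Finset.sum_add_distrib]
  have h1 : ∑ i, ∑ j, v i * (A i * star (B j)) * star (v j) = (∑ i, v i * A i) * ∑ j, star (B j) * star (v j) := by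
    rw [Finset.sum_mul_sum]
    exact Finset.sum_congr rfl fun i _ => Finset.sum_congr rfl fun j _ => by ring
  have h2 : ∑ i, ∑ j, v i * (B i * star (A j)) * star (v j) = (∑ i, v i * B i) * ∑ j, star (A j) * star (v j) := by
    rw [Finset.sum_mul_sum]
    exact Finset.sum_congr rfl fun i _ => Finset.sum_congr rfl fun j _ => by ring
  rw [h1, h2, hv', hv, mul_zero, zero_mul, add_zero]

/-! ## §4 Rank 2: the image IS the hyperplane (traces surjective) -/

omit [StarRing R] in
/-- the orthogonal vector in rank 2: `v = (B 1, −B 0)` satisfies `Σ vᵢ Bᵢ = 0`. [folklore] -/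
theorem orth_vec_two (B : Fin 2 → R) : ∑ i, ![B 1, -B 0] i * B i = 0 := by
  rw [Fin.sum_univ_two, Matrix.cons_val_zero, Matrix.cons_val_one, Matrix.cons_val_zero]
  ring

/-- **RANK 2, THE IMAGE IS THE HYPERPLANE**: `B 0` a unit, traces surjective onto self-adjoint elements (`∀ r, star r = r → ∃ t, t + star t = r`), `H` hermitian with
`Σᵢⱼ vᵢ Hᵢⱼ v̄ⱼ = 0` for `v = (B 1, −B 0)` ⇒ `∃ A, A·B* + B·A* = H`. [cite: Jacobowitz1962, §4] [cite: Shimura1997, §13] -/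
theorem exists_update_eq_of_orth (B : Fin 2 → R) (hB : IsUnit (B 0)) (htr : ∀ r : R, star r = r → ∃ t : R, t + star t = r)
    (H : Matrix (Fin 2) (Fin 2) R) (hH : Hᴴ = H) (hv : ∑ i, ∑ j, ![B 1, -B 0] i * H i j * star (![B 1, -B 0] j) = 0) :
    ∃ A : Fin 2 → R, vecMulVec A (star B) + vecMulVec B (star A) = H := by
  obtain ⟨u, hu⟩ := hB
  -- hermitian entries
  have h10 : H 1 0 = star (H 0 1) := by
    have h := congrFun (congrFun hH 1) 0
    rw [conjTranspose_apply] at h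
    exact h.symm
  have h01 : H 0 1 = star (H 1 0) := by rw [h10, star_star]
  have h00 : star (H 0 0) = H 0 0 := by
    have h := congrFun (congrFun hH 0) 0
    rw [conjTranspose_apply] at h
    exact h
  -- the unit `u = B 0`, `X = u⁻¹`, and the two unit relations
  have r1 : (u : R) * ↑u⁻¹ = 1 := Units.mul_inv u
  have r2 : star (↑u⁻¹ : R) * star (u : R) = 1 := by rw [← star_mul', Units.inv_mul, star_one]
  -- the hyperplane relation, expanded, with `B 0 = u`
  have hv' : B 1 * H 0 0 * star (B 1) - B 1 * H 0 1 * star (u : R) - (u : R) * H 1 0 * star (B 1) + (u : R) * H 1 1 * star (u : R) = 0 := by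
    simp only [Fin.sum_univ_two, Matrix.cons_val_zero, Matrix.cons_val_one, star_neg, ← hu] at hv
    rw [← hv]
    ring
  -- solve: `A 0 := t·ū⁻¹` with `t + t̄ = H 0 0`, `A 1 := (H 1 0 − B 1·Ā 0)·ū⁻¹`
  obtain ⟨t, ht⟩ := htr (H 0 0) h00
  refine ⟨![t * star (↑u⁻¹ : R), (H 1 0 - B 1 * (star t * ↑u⁻¹)) * star (↑u⁻¹ : R)], ?_⟩
  ext i j
  fin_cases i <;> fin_cases j
  · simp only [update_apply, Fin.zero_eta, Fin.isValue, Matrix.cons_val_zero, ← hu, star_mul', star_star]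
    linear_combination t * r2 + star t * r1 + ht
  · simp only [update_apply, Fin.zero_eta, Fin.mk_one, Fin.isValue, Matrix.cons_val_zero, Matrix.cons_val_one, ← hu, star_mul', star_sub, star_star]
    linear_combination (star (H 1 0) - t * star (↑u⁻¹ : R) * star (B 1)) * r1 - h01
  · simp only [update_apply, Fin.zero_eta, Fin.mk_one, Fin.isValue, Matrix.cons_val_zero, Matrix.cons_val_one, ← hu, star_mul', star_star]
    linear_combination (H 1 0 - B 1 * (star t * ↑u⁻¹)) * r2
  · simp only [update_apply, Fin.mk_one, Fin.isValue, Matrix.cons_val_one, Matrix.cons_val_fin_one, star_mul', star_sub, star_star]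
    linear_combination (-(↑u⁻¹ : R) * star (↑u⁻¹ : R)) * hv' + (H 1 1 * star (↑u⁻¹ : R) * star (u : R) - H 1 0 * star (↑u⁻¹ : R) * star (B 1)) * r1 +
      (H 1 1 - B 1 * ↑u⁻¹ * H 0 1) * r2 + (-(B 1 * (↑u⁻¹ : R))) * h01 + (-(B 1 * star (B 1) * ↑u⁻¹ * star (↑u⁻¹ : R))) * ht

end Summit.HodgeConjecture.HodgeConjecture.Cruxes.HLiu418.K2LiuHermitianRankOneUpdateKernel
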